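import Summits.Ventures.Crystal3D.Bulk.RotSysDelete
import Summits.Ventures.Crystal3D.Bulk.RotSysBridge
import Summits.Ventures.Crystal3D.Bulk.RotSysSwap
import HarnessLib

/-!
# Cutting an ear off a face of a sub-rotation-system: the dart-level splice (route 1 of
# `HOME/lean/lemmaL/DESIGN.md`, step R1.7, combinatorial half)

HONEST FRAMING. Part of the venture `Summits/Ventures/Crystal3D` (cell `pub-crystal3d`, phase 2;
seat p3), generic: `σ, α` are any rotation system on a finite dart type (typer-bulk-2's
`Bulk/RotSys*.lean`); nothing here mentions GAP(1.26). This is the combinatorial step of the ear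
induction proving that faces of the tight map are convex. Let `S` be `α`-closed and `e ∈ S` a
dart whose `S`-face `e = f₀ → f₁ → ⋯ → f_{m−1} → e` (`f_k = φ_S^k e`, `m` the period) has an
EAR at `e`: the face successor of `e` is already its AMBIENT face successor, `φ_S e = σ (α e)`,
and the ambient face through `e` is a triangle `e → f₁ → g → e` (`g := σ (α f₁)`,
`σ (α g) = e`) whose third dart `g` is not in `S`. Adding the diagonal, `S' := S ∪ {g, α g}`:

* `phi_union_ear_f1 / _g / _e` — `φ_{S'} f₁ = g`, `φ_{S'} g = e`, `φ_{S'} e = f₁` (the triangle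
  becomes a face of `S'`);
* `phi_union_ear_alpha_g`, `phi_union_ear_f`, `phi_union_ear_last` — `φ_{S'} (α g) = f₂`,
  `φ_{S'} f_i = f_{i+1}` (`2 ≤ i ≤ m − 2`), `φ_{S'} f_{m−1} = α g`: the rest of the old face closes
  up through the diagonal `α g` (from the pointwise splice `IsRotSys.phi_sdiff_apply` read
  backwards, plus injectivity of `φ_{S'}`);
* **`pow_phi_union_ear_alpha_g`** — `(φ_{S'}^k) (α g) = f_{k+1}` for `1 ≤ k ≤ m − 2`, and
  **`minimalPeriod_phi_union_ear`** — the new face of `α g` has period `m − 1`.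

So the face loses exactly the vertex at the head of `e` — the input of the gluing lemma
`convexPos_snoc` (`Bulk/ConvexPositionGluing.lean`) in the geometric half.
-/

namespace Summit.Ventures.Crystal3D

namespace RotSys

open Equiv Equiv.Perm Finset Function

variable {D : Type*} [Fintype D] [DecidableEq D] {σ α : Perm D} {S : Finset D} {e : D}

/-! ## Iterates of a face permutation: injectivity below the period -/

omit [Fintype D] [DecidableEq D] in
/-- Powers of a permutation are its iterates, pointwise. -/
theorem pow_apply_eq_iterate (π : Perm D) (k : ℕ) (x : D) : (π ^ k) x = π^[k] x := by
  rw [← Equiv.Perm.iterate_eq_pow]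

omit [Fintype D] [DecidableEq D] in
/-- Distinct exponents below the minimal period give distinct points. -/
theorem pow_apply_injOn (π : Perm D) (x : D) {i j : ℕ} (hi : i < minimalPeriod π x)
    (hj : j < minimalPeriod π x) (h : (π ^ i) x = (π ^ j) x) : i = j := by
  rw [pow_apply_eq_iterate, pow_apply_eq_iterate] at h
  exact iterate_injOn_Iio_minimalPeriod (f := π) (x := x) hi hj h

omit [Fintype D] [DecidableEq D] in
/-- The minimal period returns to the start. -/
theorem pow_minimalPeriod_apply (π : Perm D) (x : D) : (π ^ minimalPeriod π x) x = x := by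
  rw [pow_apply_eq_iterate]; exact iterate_minimalPeriod

omit [Fintype D] [DecidableEq D] in
/-- A permutation of period `m` at `x`, read after the return: `(π ^ (k + m)) x = (π ^ k) x`. -/
theorem pow_add_minimalPeriod_apply (π : Perm D) (x : D) (k : ℕ) :
    (π ^ (k + minimalPeriod π x)) x = (π ^ k) x := by
  rw [pow_add, Perm.mul_apply, pow_minimalPeriod_apply]

omit [DecidableEq D] in
/-- Characterisation of the minimal period by a first return. -/
theorem minimalPeriod_eq_of_first_return (π : Perm D) (x : D) {n : ℕ} (hn0 : 0 < n)
    (hret : (π ^ n) x = x) (hmin : ∀ k, 0 < k → k < n → (π ^ k) x ≠ x) :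
    minimalPeriod π x = n := by
  have hper : IsPeriodicPt π n x := by
    rw [IsPeriodicPt, IsFixedPt, ← pow_apply_eq_iterate]; exact hret
  have hle : minimalPeriod π x ≤ n := hper.minimalPeriod_le hn0
  rcases hle.lt_or_eq with hlt | heq
  · exfalso
    exact hmin _ (minimalPeriod_pos_perm π x) hlt (pow_minimalPeriod_apply π x)
  · exact heq

/-! ## The ear data -/

section Ear

variable (h : IsRotSys σ α) (hS : IsClosed α S) (he : e ∈ S)
  (hear : phi σ α S e = σ (α e))
  (htri : σ (α (σ (α (phi σ α S e)))) = e)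
  (hg : σ (α (phi σ α S e)) ∉ S)

/-- Darts of the face are in `S`. -/
theorem pow_phi_mem (hS : IsClosed α S) (he : e ∈ S) (k : ℕ) : (phi σ α S ^ k) e ∈ S :=
  phi_pow_apply_mem hS he k

include h hS hg in
/-- The reverse of the diagonal is not in `S` either. -/
theorem alpha_g_not_mem : α (σ (α (phi σ α S e))) ∉ S := by
  intro hmem
  have := hS _ hmem
  rw [h.α_inv] at this
  exact hg this

include h hS hg in
/-- Removing the diagonal from `S' = S ∪ {g, α g}` gives back `S`. -/
theorem union_ear_sdiff :
    (S ∪ {σ (α (phi σ α S e)), α (σ (α (phi σ α S e)))}) \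
      {σ (α (phi σ α S e)), α (σ (α (phi σ α S e)))} = S :=
  h.union_pair_sdiff hS hg

include h hS in
/-- `S'` is `α`-closed. -/
theorem isClosed_union_ear :
    IsClosed α (S ∪ {σ (α (phi σ α S e)), α (σ (α (phi σ α S e)))}) :=
  h.isClosed_union_pair hS _

/-! ### The triangle `e → f₁ → g → e` is a face of `S'` -/

include hS he in
/-- `φ_{S'} f₁ = g`. -/
theorem phi_union_ear_f1 :
    phi σ α (S ∪ {σ (α (phi σ α S e)), α (σ (α (phi σ α S e)))}) (phi σ α S e) =
      σ (α (phi σ α S e)) := by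
  set g := σ (α (phi σ α S e))
  rw [phi_apply]
  refine induce_eq_of_first_return σ ?_ Nat.one_pos (by rw [pow_one]) ?_
    (fun m hm0 hm1 => absurd hm1 (by omega))
  · exact mem_union_left _ (hS _ (phi_apply_mem hS he))
  · exact mem_union_right _ (mem_insert_self _ _)

include he htri in
/-- `φ_{S'} g = e`. -/
theorem phi_union_ear_g :
    phi σ α (S ∪ {σ (α (phi σ α S e)), α (σ (α (phi σ α S e)))}) (σ (α (phi σ α S e))) = e := by
  rw [phi_apply]
  refine induce_eq_of_first_return σ ?_ Nat.one_pos (by rw [pow_one, htri]) (mem_union_left _ he)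
    (fun m hm0 hm1 => absurd hm1 (by omega))
  exact mem_union_right _ (mem_insert_of_mem (mem_singleton_self _))

include hS he hear in
/-- `φ_{S'} e = f₁`. -/
theorem phi_union_ear_e :
    phi σ α (S ∪ {σ (α (phi σ α S e)), α (σ (α (phi σ α S e)))}) e = phi σ α S e := by
  rw [phi_apply]
  refine induce_eq_of_first_return σ (mem_union_left _ (hS _ he)) Nat.one_pos
    (by rw [pow_one, hear]) (mem_union_left _ (phi_apply_mem hS he))
    (fun m hm0 hm1 => absurd hm1 (by omega))

/-! ### The rest of the old face closes up through `α g` -/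

include h hS hg in
/-- The pointwise splice read backwards: for `x ∈ S`,
`φ_S x = if φ_{S'} x = g then φ_{S'} (α g) else if φ_{S'} x = α g then φ_{S'} g else φ_{S'} x`. -/
theorem phi_eq_splice {x : D} (hx : x ∈ S) :
    phi σ α S x =
      if phi σ α (S ∪ {σ (α (phi σ α S e)), α (σ (α (phi σ α S e)))}) x = σ (α (phi σ α S e))
      then phi σ α (S ∪ {σ (α (phi σ α S e)), α (σ (α (phi σ α S e)))}) (α (σ (α (phi σ α S e))))
      else if phi σ α (S ∪ {σ (α (phi σ α S e)), α (σ (α (phi σ α S e)))}) x =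
          α (σ (α (phi σ α S e)))
        then phi σ α (S ∪ {σ (α (phi σ α S e)), α (σ (α (phi σ α S e)))}) (σ (α (phi σ α S e)))
        else phi σ α (S ∪ {σ (α (phi σ α S e)), α (σ (α (phi σ α S e)))}) x := by
  set g := σ (α (phi σ α S e)) with hgdef
  set S' := S ∪ {g, α g} with hS'
  have hgS' : g ∈ S' := mem_union_right _ (mem_insert_self _ _)
  have hsd : S' \ {g, α g} = S := union_ear_sdiff h hS hg
  have hx' : x ∈ S' \ {g, α g} := by rw [hsd]; exact hx
  have key := h.phi_sdiff_apply (isClosed_union_ear h hS) hgS' hx'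
  rw [hsd] at key
  exact key

include h hS he hg in
/-- `φ_{S'} (α g) = f₂`. -/
theorem phi_union_ear_alpha_g :
    phi σ α (S ∪ {σ (α (phi σ α S e)), α (σ (α (phi σ α S e)))}) (α (σ (α (phi σ α S e)))) =
      (phi σ α S ^ 2) e := by
  have key := phi_eq_splice h hS hg (phi_apply_mem (σ := σ) hS he)
  rw [phi_union_ear_f1 hS he, if_pos rfl] at key
  rw [← key, pow_two, Perm.mul_apply]

include h hS he htri hg in
/-- `φ_{S'} f_i = f_{i+1}` for `2 ≤ i` with `i + 1 <` the period of the face of `e`. -/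
theorem phi_union_ear_f {i : ℕ} (hi2 : 2 ≤ i) (hi : i + 1 < minimalPeriod (phi σ α S) e) :
    phi σ α (S ∪ {σ (α (phi σ α S e)), α (σ (α (phi σ α S e)))}) ((phi σ α S ^ i) e) =
      (phi σ α S ^ (i + 1)) e := by
  set g := σ (α (phi σ α S e)) with hgdef
  set S' := S ∪ {g, α g} with hS'
  set φ := phi σ α S with hφ
  set φ' := phi σ α S' with hφ'
  have key := phi_eq_splice h hS hg (pow_phi_mem (σ := σ) hS he i)
  rw [← hgdef, ← hS', ← hφ, ← hφ'] at key
  have hstep : φ ((φ ^ i) e) = (φ ^ (i + 1)) e := by rw [pow_succ', Perm.mul_apply]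
  rw [hstep] at key
  -- `φ' (f i) ≠ g` by injectivity (`φ' f₁ = g`, `f i ≠ f 1`)
  have hf1 : φ' (φ e) = g := phi_union_ear_f1 hS he
  have hne1 : (φ ^ i) e ≠ φ e := by
    intro heq
    have := pow_apply_injOn φ e (i := i) (j := 1) (by omega) (by omega) (by rw [pow_one]; exact heq)
    omega
  have hneg : φ' ((φ ^ i) e) ≠ g := by
    intro heq
    rw [← hf1] at heq
    exact hne1 (φ'.injective heq)
  rw [if_neg hneg] at key
  -- `φ' (f i) ≠ α g`, else `f (i+1) = φ' g = e = f 0`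
  by_cases hαg : φ' ((φ ^ i) e) = α g
  · exfalso
    rw [if_pos hαg, hφ', hS', hgdef, phi_union_ear_g he htri] at key
    have := pow_apply_injOn φ e (i := i + 1) (j := 0) hi (by omega) (by rw [pow_zero]; exact key)
    omega
  · rw [if_neg hαg] at key
    exact key.symm

include h hS he htri hg in
/-- `φ_{S'} f_{m−1} = α g` (`m ≥ 3` the period of the face of `e`). -/
theorem phi_union_ear_last (hm : 3 ≤ minimalPeriod (phi σ α S) e) :
    phi σ α (S ∪ {σ (α (phi σ α S e)), α (σ (α (phi σ α S e)))})
        ((phi σ α S ^ (minimalPeriod (phi σ α S) e - 1)) e) = α (σ (α (phi σ α S e))) := by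
  set g := σ (α (phi σ α S e)) with hgdef
  set S' := S ∪ {g, α g} with hS'
  set φ := phi σ α S with hφ
  set φ' := phi σ α S' with hφ'
  set m := minimalPeriod φ e with hmdef
  have key := phi_eq_splice h hS hg (pow_phi_mem (σ := σ) hS he (m - 1))
  rw [← hgdef, ← hS', ← hφ, ← hφ'] at key
  have hstep : φ ((φ ^ (m - 1)) e) = e := by
    rw [← Perm.mul_apply, ← pow_succ', show m - 1 + 1 = m by omega, hmdef, pow_minimalPeriod_apply]
  rw [hstep] at key
  have hf1 : φ' (φ e) = g := phi_union_ear_f1 hS he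
  have hne1 : (φ ^ (m - 1)) e ≠ φ e := by
    intro heq
    have := pow_apply_injOn φ e (i := m - 1) (j := 1) (by omega) (by omega)
      (by rw [pow_one]; exact heq)
    omega
  have hneg : φ' ((φ ^ (m - 1)) e) ≠ g := by
    intro heq
    rw [← hf1] at heq
    exact hne1 (φ'.injective heq)
  rw [if_neg hneg] at key
  by_contra hαg
  rw [if_neg hαg] at key
  -- then `φ' (f (m-1)) = e = φ' g`, so `f (m-1) = g ∉ S`
  have hg' : φ' g = e := phi_union_ear_g he htri
  have heq : (φ ^ (m - 1)) e = g := φ'.injective (by rw [← key, hg'])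
  exact hg (by rw [← heq]; exact pow_phi_mem (σ := σ) hS he (m - 1))

/-! ### The new face of `α g`: iterates and period -/

include h hS he htri hg in
/-- **`(φ_{S'}^k) (α g) = f_{k+1}` for `1 ≤ k ≤ m − 2`.** -/
theorem pow_phi_union_ear_alpha_g {k : ℕ} (hk1 : 1 ≤ k)
    (hk : k + 2 ≤ minimalPeriod (phi σ α S) e) :
    (phi σ α (S ∪ {σ (α (phi σ α S e)), α (σ (α (phi σ α S e)))}) ^ k)
        (α (σ (α (phi σ α S e)))) = (phi σ α S ^ (k + 1)) e := by
  induction k with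
  | zero => exact absurd hk1 (by omega)
  | succ k ih =>
    rcases Nat.eq_zero_or_pos k with rfl | hkpos
    · rw [zero_add, pow_one]
      exact phi_union_ear_alpha_g h hS he hg
    · rw [pow_succ', Perm.mul_apply, ih hkpos (by omega)]
      exact phi_union_ear_f h hS he htri hg (by omega) (by omega)

include h hS he htri hg in
/-- The new face returns to `α g` after `m − 1` steps. -/
theorem pow_phi_union_ear_return (hm : 3 ≤ minimalPeriod (phi σ α S) e) :
    (phi σ α (S ∪ {σ (α (phi σ α S e)), α (σ (α (phi σ α S e)))}) ^
        (minimalPeriod (phi σ α S) e - 1)) (α (σ (α (phi σ α S e)))) =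
      α (σ (α (phi σ α S e))) := by
  set m := minimalPeriod (phi σ α S) e with hmdef
  rw [show m - 1 = (m - 2) + 1 by omega, pow_succ', Perm.mul_apply,
    pow_phi_union_ear_alpha_g h hS he htri hg (by omega) (by omega),
    show m - 2 + 1 = m - 1 by omega]
  exact phi_union_ear_last h hS he htri hg hm

include h hS he htri hg in
/-- **The new face of `α g` has period `m − 1`.** -/
theorem minimalPeriod_phi_union_ear (hm : 3 ≤ minimalPeriod (phi σ α S) e) :
    minimalPeriod (phi σ α (S ∪ {σ (α (phi σ α S e)), α (σ (α (phi σ α S e)))}))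
        (α (σ (α (phi σ α S e)))) = minimalPeriod (phi σ α S) e - 1 := by
  refine minimalPeriod_eq_of_first_return _ _ (by omega)
    (pow_phi_union_ear_return h hS he htri hg hm) ?_
  intro k hk0 hk heq
  rw [pow_phi_union_ear_alpha_g h hS he htri hg hk0 (by omega)] at heq
  -- `f (k+1) ∈ S` but `α g ∉ S`
  exact alpha_g_not_mem h hS hg (by rw [← heq]; exact pow_phi_mem (σ := σ) hS he (k + 1))

end Ear

end RotSys

end Summit.Ventures.Crystal3D
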